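import Literature.Computability.Complexity.UniversalTM2
import HarnessLib

/-!
# Flat programs: a first-order, table-free normal form of standard `TM2` machines

Companion of `PolyTimeCountable.lean` (every bundled machine `Turing.TM2ComputableAux Γ₀ Γ₁` is
simulated step for step by a *standard machine* `TM2Std.SCode`: stack indices, labels, states and
the shared stack alphabet all of the form `Fin _`, statements the first-order trees
`TM2Std.SStmt`) and second stage of the tree's *efficient* universal machine (Arora–Barak 2009,
§1.4 "Machines as strings and the universal Turing machine", Thm. 1.9; Hennie–Stearns 1966): the
statement trees of a standard machine, whose nodes carry finite FUNCTION TABLES on the state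
(`push k f q` pushes `f state`, `pop k f q` moves to state `f state top`, `branch p q₁ q₂`, `load`,
`goto f`), are compiled into a **flat program** — a list of three kinds of table-free
instructions acting on a program counter and `nK` stacks of symbol numbers (coded as in
`UniversalTM2.lean`, `UnivTM2.encStk`),

* `goto j`, `push k a j` (push the symbol `a` on stack `k`, continue at `j`),
  `pop k t` (pop stack `k`; continue at `t[0]` if it was empty, at `t[a+1]` if the top was `a`),

by *folding the internal state into the program counter*: statement `q` is laid out as `nσ`
consecutive blocks, block `s` being `q` specialised to state `s` (`FlatProg.code`), followed by the
code of its sub-statements; `goto f` in state `s` jumps to the entry of label `f s` at state `s`,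
`halt` jumps to the address `H = |program|` (program counter at or beyond the end = halted, the
step function is then the identity, as for the tree's stack register machines `SProg`/`AProg` of
`StackMachines.lean`/`SymbolPrograms.lean`). A `peek` becomes a `pop` followed by pushing the
symbol back (one push-back instruction per symbol).

Main results:

* `FlatProg.step` — the total one-step semantics on untyped configurations
  `ℕ × List (List ℕ)` (junk-tolerant: out-of-range tables read `0`, a missing stack reads `[]`);
* `FlatProg.code`, `FlatProg.compile` — compilation of one statement / of a standard machine
  `c : TM2Std.SCode` (`FlatProg.entry c l s`: entry address of label `l` at state `s`,
  `FlatProg.haltAddr c = (compile c).length`);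
* `FlatProg.runs_code` — one statement: from the address of block `s` of `q` with coded stacks
  `S`, the flat program reaches, in `≥ 1` steps all taken inside the program, the coded result of
  `Turing.TM2.stepAux q.toStmt s S` (label `l'`/state `s'` ↦ entry of `l'` at `s'`, `halt` ↦ `H`);
* `FlatProg.runs_step`, `FlatProg.step_trCfg_of_none` (`FlatProg.trCfg_fst_of_none`) — one
  machine step of `c.tm` is matched by a positive number of flat steps inside the program; a
  halted configuration is coded by a fixed point with program counter `H`;
* `FlatProg.exists_iterate_of_iterate`, `FlatProg.fst_iterate_lt_of_isSome`,
  `FlatProg.exists_iterate_eq_of_mem_eval` — runs: `t` machine steps are matched by `≥ t` flat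
  steps, the flat program counter stays `< H` as long as the machine has not halted, and a
  halting run ends in the fixed code of the halting configuration;
* `FlatProg.RunsPosB`, `FlatProg.runsB_code`, `FlatProg.runsB_step`, `FlatProg.stkTotal`,
  `FlatProg.stkTotal_step_le`, `FlatProg.stkTotal_iterate_le` — the counted form: one statement
  takes `≤ csize q` flat steps (`runsB_code`), one machine step `≤ haltAddr c` (`runsB_step`),
  and a flat step adds `≤ 1` stack symbol (`stkTotal_step_le`, `stkTotal_iterate_le`).

Composed with `TM2Std.iterate_tr` (`PolyTimeCountable.lean`) this flattens every
`Turing.FinTM2` computation; the string coding of flat configurations and the proof that `step`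
is ONE polynomial-time string function, uniformly in the program (the universal step), are the
sequel `UniversalStep.lean`. The only overhead bounds proved are the ones just listed — what the
space bound of the universal simulation between two machine-step boundaries needs
(`SpaceTMSATHard.lean`); no time bound tighter than that is claimed.

**Delta against the tree.** `UniversalTM2.lean` already interprets the SAME standard machines
on the SAME stack coding (`UnivTM2.encStk`, `UnivTM2.encCfg = (label, state, stacks)`), but by an
INTERPRETER that walks the coded statement tree and its tables anew at every step
(`UnivTM2.descend`/`ustep`, primitive recursive on `ℕ`-codes); here the tables are compiled away
once and for all into a flat program, so that one machine step becomes finitely many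
constant-size instructions — the form a polynomial-time universal STEP function can execute
(sequel). `SymbolPrograms.lean` has flat programs `AInstr`/`AProg` too, but with typed
registers `ι`, symbols of a fixed type `Γ`, a function-valued `pop k (j : Option Γ → ℕ)` and a
fall-through `push`; the untyped `ℕ`/`List ℕ` instructions below make ONE type `Prog` cover the
compiled programs of all machines at once, which is what a universal machine needs.

Mathlib has no universal Turing machine and no normal form of `TM2` programs (searched
`Computability/TuringMachine/*`, `TMToPartrec`, `PostTuringMachine`); folding a finite control
into the program is folklore (Minsky 1967, §11.1: program machines; Arora–Barak 2009, §1.4: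
"machines as strings", §1.3.1: robustness of the model).

## References

* S. Arora, B. Barak, *Computational Complexity: A Modern Approach*, CUP 2009, §1.4 (machines as
  strings and the universal Turing machine), §1.3.1 (robustness of the definition)
  [AroraBarakCC2009].
* M. L. Minsky, *Computation: Finite and Infinite Machines*, Prentice-Hall 1967, §11.1, §14.1
  (program machines with push-down registers). (Not held; standard.)
* Mathlib `Mathlib/Computability/TuringMachine/StackTuringMachine.lean` (`Turing.TM2.stepAux`).
-/

namespace Literature.Computability.Complexity

namespace FlatProg

open Turing TM2Std Function
open UnivTM2 (encStk encStk_getD encStk_update)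

/-! ### Flat programs and their one-step semantics -/

/-- Instructions of a flat program: `goto j`; `push k a j` (push symbol `a` on stack `k`, then go
to `j`); `pop k t` (pop stack `k`: if it was empty go to `t[0]`, if its top was `a` go to
`t[a+1]`). [cite: AroraBarakCC2009, §1.4 (machines as strings)] -/
inductive Instr : Type
  | goto (j : ℕ)
  | push (k a j : ℕ)
  | pop (k : ℕ) (t : List ℕ)
  deriving DecidableEq, Inhabited

/-- A flat program is a list of instructions (addresses = positions). [cite: AroraBarakCC2009, §1.4] -/
abbrev Prog : Type := List Instr

/-- Untyped configurations: program counter and the stacks (lists of symbol numbers, top first).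
[cite: AroraBarakCC2009, §1.4] -/
abbrev Cfg : Type := ℕ × List (List ℕ)

/-- The jump-table index of an optional top symbol: `0` for an empty stack, `a + 1` for top `a`.
[folklore] -/
def tblIdx : Option ℕ → ℕ
  | none => 0
  | some a => a + 1

/-- Executing one instruction on the stacks (junk-tolerant: missing entries read `0` / `[]`).
[cite: AroraBarakCC2009, §1.4] -/
def Instr.apply : Instr → List (List ℕ) → Cfg
  | .goto j, S => (j, S)
  | .push k a j, S => (j, S.modify k (fun l => a :: l))
  | .pop k t, S => (t.getD (tblIdx (S.getD k []).head?) 0, S.set k (S.getD k []).tail)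

/-- **One step of a flat program** (total): fetch the instruction at the program counter and
apply it; a program counter at or beyond the end of the program means *halted* (identity).
[cite: AroraBarakCC2009, §1.4] -/
def step (P : Prog) (c : Cfg) : Cfg :=
  match P[c.1]? with
  | none => c
  | some i => i.apply c.2

/-- A halted configuration is a fixed point. [folklore] -/
theorem step_of_le {P : Prog} {c : Cfg} (h : P.length ≤ c.1) : step P c = c := by
  unfold step
  rw [List.getElem?_eq_none h]

/-- Halted configurations stay fixed under iteration. [folklore] -/
theorem iterate_step_of_le {P : Prog} {c : Cfg} (h : P.length ≤ c.1) (n : ℕ) :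
    (step P)^[n] c = c := by
  induction n with
  | zero => rfl
  | succ n ih => rw [iterate_succ_apply, step_of_le h, ih]

/-- The step at a fetchable address. [folklore] -/
theorem step_of_getElem? {P : Prog} {c : Cfg} {i : Instr} (h : P[c.1]? = some i) :
    step P c = i.apply c.2 := by
  unfold step
  rw [h]

/-! ### Runs inside the program -/

/-- `Runs P a b`: iterating `step P` from `a` reaches `b`, every configuration met strictly
before the end having its program counter inside the program (so none of them is halted).
[folklore] -/
def Runs (P : Prog) (a b : Cfg) : Prop :=
  ∃ n, (step P)^[n] a = b ∧ ∀ m < n, ((step P)^[m] a).1 < P.length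

/-- `RunsPos P a b`: as `Runs`, in at least one step. [folklore] -/
def RunsPos (P : Prog) (a b : Cfg) : Prop :=
  ∃ n, 0 < n ∧ (step P)^[n] a = b ∧ ∀ m < n, ((step P)^[m] a).1 < P.length

/-- Zero steps. [folklore] -/
theorem Runs.refl (P : Prog) (a : Cfg) : Runs P a a :=
  ⟨0, rfl, fun m hm => absurd hm (Nat.not_lt_zero m)⟩

/-- One step from a fetchable address. [folklore] -/
theorem RunsPos.single {P : Prog} {a : Cfg} {i : Instr} (h : P[a.1]? = some i) :
    RunsPos P a (i.apply a.2) :=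
  ⟨1, Nat.one_pos, by rw [iterate_one, step_of_getElem? h], fun m hm => by
    have hm0 : m = 0 := by omega
    subst hm0
    exact (List.getElem?_eq_some_iff.1 h).1⟩

/-- Composition of runs. [folklore] -/
theorem Runs.trans {P : Prog} {a b c : Cfg} (h₁ : Runs P a b) (h₂ : Runs P b c) : Runs P a c := by
  obtain ⟨n₁, e₁, p₁⟩ := h₁
  obtain ⟨n₂, e₂, p₂⟩ := h₂
  refine ⟨n₂ + n₁, by rw [iterate_add_apply, e₁, e₂], fun m hm => ?_⟩
  by_cases hm₁ : m < n₁
  · exact p₁ m hm₁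
  · obtain ⟨d, rfl⟩ := Nat.exists_eq_add_of_le (le_of_not_gt hm₁)
    rw [add_comm n₁ d, iterate_add_apply, e₁]
    exact p₂ d (by omega)

/-- A positive run followed by a run is a positive run. [folklore] -/
theorem RunsPos.trans_runs {P : Prog} {a b c : Cfg} (h₁ : RunsPos P a b) (h₂ : Runs P b c) :
    RunsPos P a c := by
  obtain ⟨n₁, hn₁, e₁, p₁⟩ := h₁
  obtain ⟨n, e, p⟩ := Runs.trans ⟨n₁, e₁, p₁⟩ h₂
  obtain ⟨n₂, e₂, p₂⟩ := h₂
  refine ⟨n₂ + n₁, by omega, by rw [iterate_add_apply, e₁, e₂], fun m hm => ?_⟩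
  by_cases hm₁ : m < n₁
  · exact p₁ m hm₁
  · obtain ⟨d, rfl⟩ := Nat.exists_eq_add_of_le (le_of_not_gt hm₁)
    rw [add_comm n₁ d, iterate_add_apply, e₁]
    exact p₂ d (by omega)

/-- A positive run is a run. [folklore] -/
theorem RunsPos.runs {P : Prog} {a b : Cfg} (h : RunsPos P a b) : Runs P a b := by
  obtain ⟨n, -, e, p⟩ := h
  exact ⟨n, e, p⟩

/-- `RunsPosB P B a b`: as `RunsPos`, in at most `B` steps. [folklore] -/
def RunsPosB (P : Prog) (B : ℕ) (a b : Cfg) : Prop :=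
  ∃ n, 0 < n ∧ n ≤ B ∧ (step P)^[n] a = b ∧ ∀ m < n, ((step P)^[m] a).1 < P.length

/-- A bounded positive run is a positive run. [folklore] -/
theorem RunsPosB.runsPos {P : Prog} {B : ℕ} {a b : Cfg} (h : RunsPosB P B a b) : RunsPos P a b := by
  obtain ⟨n, hn, -, e, p⟩ := h
  exact ⟨n, hn, e, p⟩

/-- Monotonicity of the bound. [folklore] -/
theorem RunsPosB.mono {P : Prog} {B B' : ℕ} {a b : Cfg} (h : RunsPosB P B a b) (hB : B ≤ B') :
    RunsPosB P B' a b := by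
  obtain ⟨n, hn, hnB, e, p⟩ := h
  exact ⟨n, hn, hnB.trans hB, e, p⟩

/-- One step from a fetchable address, bounded by `1`. [folklore] -/
theorem RunsPosB.single {P : Prog} {a : Cfg} {i : Instr} (h : P[a.1]? = some i) :
    RunsPosB P 1 a (i.apply a.2) := by
  refine ⟨1, Nat.one_pos, le_rfl, by rw [iterate_one, step_of_getElem? h], fun m hm => ?_⟩
  have hm0 : m = 0 := by omega
  subst hm0
  exact (List.getElem?_eq_some_iff.1 h).1

/-- A bounded positive run followed by a bounded positive run. [folklore] -/
theorem RunsPosB.trans {P : Prog} {B₁ B₂ : ℕ} {a b c : Cfg} (h₁ : RunsPosB P B₁ a b)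
    (h₂ : RunsPosB P B₂ b c) : RunsPosB P (B₁ + B₂) a c := by
  obtain ⟨n₁, hn₁, hB₁, e₁, p₁⟩ := h₁
  obtain ⟨n₂, -, hB₂, e₂, p₂⟩ := h₂
  refine ⟨n₂ + n₁, by omega, by omega, by rw [iterate_add_apply, e₁, e₂], fun m hm => ?_⟩
  by_cases hm₁ : m < n₁
  · exact p₁ m hm₁
  · obtain ⟨d, rfl⟩ := Nat.exists_eq_add_of_le (le_of_not_gt hm₁)
    rw [add_comm n₁ d, iterate_add_apply, e₁]
    exact p₂ d (by omega)

/-! ### Indexing into concatenated blocks -/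

/-- Indexing into a concatenation of blocks of a common length `b`: position `s * b + i`, `i < b`,
is position `i` of block `s`. [folklore] -/
theorem getElem?_flatten_of_length_eq {α : Type} (b : ℕ) :
    ∀ (L : List (List α)), (∀ l ∈ L, l.length = b) → ∀ (s i : ℕ), i < b →
      L.flatten[s * b + i]? = L[s]?.bind fun l => l[i]?
  | [], _, s, i, _ => by simp
  | l :: L, hL, 0, i, hi => by
    have hl : l.length = b := hL l (by simp)
    rw [Nat.zero_mul, Nat.zero_add, List.flatten_cons, List.getElem?_cons_zero, Option.bind_some]
    exact List.getElem?_append_left (by omega)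
  | l :: L, hL, s + 1, i, hi => by
    have hl : l.length = b := hL l (by simp)
    simp only [List.flatten_cons, List.getElem?_cons_succ]
    rw [List.getElem?_append_right (by rw [hl, Nat.succ_mul]; omega),
      show (s + 1) * b + i - l.length = s * b + i by rw [hl, Nat.succ_mul]; omega]
    exact getElem?_flatten_of_length_eq b L (fun l' hl' => hL l' (by simp [hl'])) s i hi

/-- Indexing into a concatenation of blocks of arbitrary lengths: position
`(|L₀| + … + |L_{s-1}|) + i`, `i < |L_s|`, is position `i` of block `s`. [folklore] -/
theorem getElem?_flatten_offset {α : Type} :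
    ∀ (L : List (List α)) (s : ℕ) (l : List α), L[s]? = some l → ∀ i : ℕ, i < l.length →
      L.flatten[((L.take s).map List.length).sum + i]? = l[i]?
  | [], s, l, hs, _, _ => by simp at hs
  | l' :: L, 0, l, hs, i, hi => by
    simp only [List.getElem?_cons_zero, Option.some.injEq] at hs
    subst hs
    rw [List.take_zero, List.map_nil, List.sum_nil, Nat.zero_add, List.flatten_cons,
      List.getElem?_append_left hi]
  | l' :: L, s + 1, l, hs, i, hi => by
    rw [List.getElem?_cons_succ] at hs
    rw [List.take_succ_cons, List.map_cons, List.sum_cons, List.flatten_cons,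
      List.getElem?_append_right (by omega),
      show l'.length + ((L.take s).map List.length).sum + i - l'.length =
        ((L.take s).map List.length).sum + i by omega]
    exact getElem?_flatten_offset L s l hs i hi

/-! ### Coded stacks -/

section Stacks

variable {nK N : ℕ}

-- The untyped stack coding `UnivTM2.encStk S = List.ofFn fun k => (S k).map Fin.val` and its
-- read/write lemmas `UnivTM2.encStk_getD`, `UnivTM2.encStk_update` are those of `UniversalTM2.lean`.

/-- Pushing on a coded stack. [folklore] -/
theorem modify_encStk (S : Fin nK → List (Fin (N + 1))) (k : Fin nK) (a : Fin (N + 1)) :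
    (encStk S).modify k.val (fun l => a.val :: l) = encStk (update S k (a :: S k)) := by
  apply List.ext_getElem?
  intro j
  rw [UnivTM2.encStk, UnivTM2.encStk, List.getElem?_modify, List.getElem?_ofFn, List.getElem?_ofFn]
  by_cases hkj : k.val = j
  · subst hkj
    simp [k.isLt]
  · by_cases hj : j < nK
    · rw [dif_pos hj, dif_pos hj, update_of_ne (fun h => hkj (by rw [← h]))]
      simp [hkj]
    · rw [dif_neg hj, dif_neg hj]
      rfl

/-- The jump-table index of the top of a coded stack. [folklore] -/
theorem tblIdx_head?_map (L : List (Fin (N + 1))) :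
    tblIdx (L.map Fin.val).head? = L.head?.elim 0 fun a => a.val + 1 := by
  cases L <;> rfl

/-- The jump table of a transition on the optional top symbol: entry `0` for the empty stack,
entry `a + 1` for top symbol `a`. [folklore] -/
def tblOf (g : Option (Fin (N + 1)) → ℕ) : List ℕ :=
  g none :: List.ofFn fun a : Fin (N + 1) => g (some a)

/-- Looking up the jump table at the index of an optional top symbol. [folklore] -/
theorem getD_tblOf (g : Option (Fin (N + 1)) → ℕ) (o : Option (Fin (N + 1))) :
    (tblOf g).getD (o.elim 0 fun a => a.val + 1) 0 = g o := by
  cases o with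
  | none => rfl
  | some a =>
    show (g none :: List.ofFn fun a => g (some a))[a.val + 1]?.getD 0 = g (some a)
    rw [List.getElem?_cons_succ, List.getElem?_ofFn, dif_pos a.isLt]
    rfl

/-- A jump table has `N + 2` entries. [folklore] -/
theorem length_tblOf (g : Option (Fin (N + 1)) → ℕ) : (tblOf g).length = N + 2 := by
  simp [tblOf]

end Stacks

/-! ### Compilation of one statement -/

section Compile

variable {nK N nΛ nσ : ℕ} (E : Fin nΛ → Fin nσ → ℕ) (H : ℕ)

/-- The length of one state block of a statement: `N + 2` for `peek` (a pop and `N + 1`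
push-backs), `1` otherwise. [folklore] -/
def blen : SStmt nK N nΛ nσ → ℕ
  | .peek _ _ _ => N + 2
  | _ => 1

/-- The size of the code of a statement: `nσ` state blocks, then the code of the
sub-statements. [folklore] -/
def csize : SStmt nK N nΛ nσ → ℕ
  | .push _ _ q => nσ + csize q
  | .peek _ _ q => nσ * (N + 2) + csize q
  | .pop _ _ q => nσ + csize q
  | .load _ q => nσ + csize q
  | .branch _ q₁ q₂ => nσ + csize q₁ + csize q₂
  | .goto _ => nσ
  | .halt => nσ

/-- The address of the state-`s` block of a statement placed at `base`. [folklore] -/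
def addr (q : SStmt nK N nΛ nσ) (s : Fin nσ) (base : ℕ) : ℕ :=
  base + s.val * blen q

/-- The state blocks of a one-instruction-per-state statement. [folklore] -/
def blocks₁ (g : Fin nσ → Instr) : List Instr :=
  (List.ofFn fun s => [g s]).flatten

/-- The state blocks of a `peek`: for each state a `pop` followed by `N + 1` push-backs.
[folklore] -/
def blocksP (g₀ : Fin nσ → Instr) (g : Fin nσ → Fin (N + 1) → Instr) : List Instr :=
  (List.ofFn fun s => g₀ s :: List.ofFn (g s)).flatten

/-- **Compilation of a statement** placed at address `base`, with label entry table `E` and halt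
address `H`: `nσ` blocks (block `s` = the statement specialised to state `s`, its tables
evaluated), followed by the code of the sub-statements. [cite: AroraBarakCC2009, §1.4 (machines as strings)] -/
def code : SStmt nK N nΛ nσ → ℕ → List Instr
  | .push k f q, base =>
      blocks₁ (fun s => Instr.push k.val (f s).val (addr q s (base + nσ))) ++ code q (base + nσ)
  | .peek k f q, base =>
      blocksP (fun s => Instr.pop k.val ((addr q (f s none) (base + nσ * (N + 2))) ::
          List.ofFn fun a : Fin (N + 1) => base + s.val * (N + 2) + (a.val + 1)))
        (fun s a => Instr.push k.val a.val (addr q (f s (some a)) (base + nσ * (N + 2)))) ++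
        code q (base + nσ * (N + 2))
  | .pop k f q, base =>
      blocks₁ (fun s => Instr.pop k.val (tblOf fun o => addr q (f s o) (base + nσ))) ++
        code q (base + nσ)
  | .load f q, base =>
      blocks₁ (fun s => Instr.goto (addr q (f s) (base + nσ))) ++ code q (base + nσ)
  | .branch p q₁ q₂, base =>
      blocks₁ (fun s => Instr.goto
          (if p s then addr q₁ s (base + nσ) else addr q₂ s (base + nσ + csize q₁))) ++
        (code q₁ (base + nσ) ++ code q₂ (base + nσ + csize q₁))
  | .goto f, _ => List.ofFn fun s : Fin nσ => Instr.goto (E (f s) s)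
  | .halt, _ => List.ofFn fun _ : Fin nσ => Instr.goto H

/-- One-instruction blocks have total length `nσ`. [folklore] -/
@[simp] theorem length_blocks₁ (g : Fin nσ → Instr) : (blocks₁ g).length = nσ := by
  simp [blocks₁, List.sum_ofFn]

/-- The blocks of a `peek` have total length `nσ · (N + 2)`. [folklore] -/
@[simp] theorem length_blocksP (g₀ : Fin nσ → Instr) (g : Fin nσ → Fin (N + 1) → Instr) :
    (blocksP g₀ g).length = nσ * (N + 2) := by
  simp [blocksP, List.sum_ofFn]

/-- The code of a statement has length `csize`. [folklore] -/
theorem length_code : ∀ (q : SStmt nK N nΛ nσ) (base : ℕ), (code E H q base).length = csize q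
  | .push k f q, base => by rw [code, List.length_append, length_blocks₁, length_code q, csize]
  | .peek k f q, base => by rw [code, List.length_append, length_blocksP, length_code q, csize]
  | .pop k f q, base => by rw [code, List.length_append, length_blocks₁, length_code q, csize]
  | .load f q, base => by rw [code, List.length_append, length_blocks₁, length_code q, csize]
  | .branch p q₁ q₂, base => by
    rw [code, List.length_append, List.length_append, length_blocks₁, length_code q₁,
      length_code q₂, csize, Nat.add_assoc]
  | .goto f, base => by rw [code, List.length_ofFn, csize]
  | .halt, base => by rw [code, List.length_ofFn, csize]

/-- Block `s` lies inside `n` blocks of length `b` (followed by `c` more instructions).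
[folklore] -/
theorem block_lt {s n b i : ℕ} (hs : s < n) (hi : i < b) (c : ℕ) : s * b + i < n * b + c :=
  calc s * b + i < s * b + b := by omega
    _ = (s + 1) * b := by rw [Nat.succ_mul]
    _ ≤ n * b := Nat.mul_le_mul_right b hs
    _ ≤ n * b + c := Nat.le_add_right _ _

/-- Fetching in one-instruction blocks. [folklore] -/
theorem getElem?_blocks₁ (g : Fin nσ → Instr) (rest : List Instr) (s : Fin nσ) :
    (blocks₁ g ++ rest)[s.val * 1]? = some (g s) := by
  rw [List.getElem?_append_left (by rw [length_blocks₁]; have := s.isLt; omega), blocks₁,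
    show s.val * 1 = s.val * 1 + 0 by rfl,
    getElem?_flatten_of_length_eq 1 _ (List.forall_mem_ofFn_iff.2 fun _ => rfl) s.val 0 Nat.one_pos,
    List.getElem?_ofFn, dif_pos s.isLt]
  rfl

/-- Fetching the `pop` of a `peek` block. [folklore] -/
theorem getElem?_blocksP_zero (g₀ : Fin nσ → Instr) (g : Fin nσ → Fin (N + 1) → Instr)
    (rest : List Instr) (s : Fin nσ) :
    (blocksP g₀ g ++ rest)[s.val * (N + 2)]? = some (g₀ s) := by
  rw [List.getElem?_append_left (by
      rw [length_blocksP]; have h := block_lt s.isLt (show 0 < N + 2 by omega) 0; omega), blocksP,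
    show s.val * (N + 2) = s.val * (N + 2) + 0 by rfl,
    getElem?_flatten_of_length_eq (N + 2) _ (List.forall_mem_ofFn_iff.2 fun _ => by simp)
      s.val 0 (by omega),
    List.getElem?_ofFn, dif_pos s.isLt]
  rfl

/-- Fetching a push-back of a `peek` block. [folklore] -/
theorem getElem?_blocksP_succ (g₀ : Fin nσ → Instr) (g : Fin nσ → Fin (N + 1) → Instr)
    (rest : List Instr) (s : Fin nσ) (a : Fin (N + 1)) :
    (blocksP g₀ g ++ rest)[s.val * (N + 2) + (a.val + 1)]? = some (g s a) := by
  rw [List.getElem?_append_left (by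
      rw [length_blocksP]; exact block_lt s.isLt (show a.val + 1 < N + 2 by omega) 0),
    blocksP,
    getElem?_flatten_of_length_eq (N + 2) _ (List.forall_mem_ofFn_iff.2 fun _ => by simp)
      s.val (a.val + 1) (by omega),
    List.getElem?_ofFn, dif_pos s.isLt, Option.bind_some, List.getElem?_cons_succ,
    List.getElem?_ofFn, dif_pos a.isLt]

/-- `Placed P q base`: the code of `q` compiled for address `base` sits in `P` at `base`.
[folklore] -/
def Placed (P : Prog) (q : SStmt nK N nΛ nσ) (base : ℕ) : Prop :=
  ∀ i, i < csize q → P[base + i]? = (code E H q base)[i]?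

variable {E H}

/-- A placed code `pre ++ code q' ++ rest` places the code of `q'` after `pre`. [folklore] -/
theorem placed_of_append {P : Prog} {q q' : SStmt nK N nΛ nσ} {base base' : ℕ}
    (hP : Placed E H P q base) (pre rest : List Instr)
    (hcode : code E H q base = pre ++ (code E H q' base' ++ rest))
    (hbase : base' = base + pre.length) (hsize : pre.length + csize q' ≤ csize q) :
    Placed E H P q' base' := by
  subst hbase
  intro i hi
  rw [Nat.add_assoc, hP _ (by omega), hcode, List.getElem?_append_right (by omega),
    Nat.add_sub_cancel_left, List.getElem?_append_left (by rw [length_code]; exact hi)]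

/-- Fetching from a placed statement. [folklore] -/
theorem Placed.getElem? {P : Prog} {q : SStmt nK N nΛ nσ} {base : ℕ} (hP : Placed E H P q base)
    {i : ℕ} (hi : i < csize q) : P[base + i]? = (code E H q base)[i]? :=
  hP i hi

/-- The coded result of executing a statement: label `l'` at state `s'` ↦ the entry address of
`l'` at `s'`, `halt` ↦ `H`; stacks coded. [folklore] -/
def fin (c : TM2.Cfg (fun _ : Fin nK => Fin (N + 1)) (Fin nΛ) (Fin nσ)) : Cfg :=
  (c.l.elim H fun l => E l c.var, encStk c.stk)

/-- **Simulation of one statement, with a step count.** If the code of `q` is placed in `P` at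
`base`, then from the address of its state-`s` block with coded stacks `S` the flat program
reaches, in at least one and at most `csize q` steps and without leaving the program on the way,
the coded result of `TM2.stepAux q s S`. [cite: AroraBarakCC2009, §1.4 (machines as strings)] -/
theorem runsB_code {P : Prog} : ∀ (q : SStmt nK N nΛ nσ) (base : ℕ), Placed E H P q base →
    ∀ (s : Fin nσ) (S : Fin nK → List (Fin (N + 1))),
      RunsPosB P (csize q) (addr q s base, encStk S) (fin (E := E) (H := H) (TM2.stepAux q.toStmt s S))
  | .push k f q, base, hP, s, S => by
    have hq : Placed E H P q (base + nσ) :=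
      placed_of_append hP _ [] (by rw [code, List.append_nil]) (by rw [length_blocks₁])
        (by rw [length_blocks₁, csize])
    have hfetch : P[(addr (.push k f q) s base, encStk S).1]? =
        some (Instr.push k.val (f s).val (addr q s (base + nσ))) := by
      show P[base + s.val * 1]? = _
      rw [hP.getElem? (by rw [csize]; have := s.isLt; omega), code, getElem?_blocks₁]
    refine ((RunsPosB.single hfetch).trans (B₂ := csize q) ?_).mono (by rw [csize]; have := s.isLt; omega)
    dsimp only
    rw [Instr.apply, modify_encStk]
    simpa only [SStmt.toStmt, TM2.stepAux] using runsB_code q (base + nσ) hq s _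
  | .peek k f q, base, hP, s, S => by
    have hq : Placed E H P q (base + nσ * (N + 2)) :=
      placed_of_append hP _ [] (by rw [code, List.append_nil]) (by rw [length_blocksP])
        (by rw [length_blocksP, csize])
    have hfetch : P[(addr (.peek k f q) s base, encStk S).1]? =
        some (Instr.pop k.val ((addr q (f s none) (base + nσ * (N + 2))) ::
          List.ofFn fun a : Fin (N + 1) => base + s.val * (N + 2) + (a.val + 1))) := by
      show P[base + s.val * (N + 2)]? = _
      rw [hP.getElem? (by rw [csize]; have h := block_lt s.isLt (show 0 < N + 2 by omega) (csize q); omega),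
        code, getElem?_blocksP_zero]
    have hbound : 1 + (1 + csize q) ≤ csize (SStmt.peek k f q) := by
      rw [csize]; have := Nat.mul_le_mul_right (N + 2) (Nat.succ_le_of_lt s.pos); omega
    refine RunsPosB.mono ?_ hbound
    refine (RunsPosB.single hfetch).trans ?_
    dsimp only
    rw [Instr.apply, encStk_getD, tblIdx_head?_map]
    cases hS : S k with
    | nil =>
      have hset : (encStk S).set k.val (List.map Fin.val ([] : List (Fin (N + 1)))).tail =
          encStk S := by
        rw [List.map_nil, List.tail_nil, show ([] : List ℕ) = List.map Fin.val ([] : List (Fin (N + 1)))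
          from rfl, ← encStk_update, update_eq_self_iff.2 hS.symm]
      rw [hset]
      have := (runsB_code q (base + nσ * (N + 2)) hq (f s none) S).mono (Nat.le_add_left _ 1)
      simpa only [SStmt.toStmt, TM2.stepAux, hS, List.head?_nil, Option.elim,
        List.getD_cons_zero] using this
    | cons a L =>
      have hidx : (addr q (f s none) (base + nσ * (N + 2)) ::
          List.ofFn fun a : Fin (N + 1) => base + s.val * (N + 2) + (a.val + 1)).getD
            ((a :: L).head?.elim 0 fun a => a.val + 1) 0 = base + s.val * (N + 2) + (a.val + 1) := by
        show (_ :: List.ofFn fun a : Fin (N + 1) => base + s.val * (N + 2) + (a.val + 1))[a.val + 1]?.getD 0 = _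
        rw [List.getElem?_cons_succ, List.getElem?_ofFn, dif_pos a.isLt]
        rfl
      rw [hidx, List.map_cons, List.tail_cons, ← encStk_update]
      -- the push-back
      have hfetch' : P[(base + s.val * (N + 2) + (a.val + 1), encStk (update S k L)).1]? =
          some (Instr.push k.val a.val (addr q (f s (some a)) (base + nσ * (N + 2)))) := by
        show P[base + s.val * (N + 2) + (a.val + 1)]? = _
        rw [Nat.add_assoc, hP.getElem? (by rw [csize]; exact block_lt s.isLt (show a.val + 1 < N + 2 by omega) _),
          code, getElem?_blocksP_succ]
      refine (RunsPosB.single hfetch').trans ?_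
      dsimp only
      rw [Instr.apply, modify_encStk, update_self, update_idem, ← hS, update_eq_self]
      have := runsB_code q (base + nσ * (N + 2)) hq (f s (some a)) S
      simpa only [SStmt.toStmt, TM2.stepAux, hS, List.head?_cons] using this
  | .pop k f q, base, hP, s, S => by
    have hq : Placed E H P q (base + nσ) :=
      placed_of_append hP _ [] (by rw [code, List.append_nil]) (by rw [length_blocks₁])
        (by rw [length_blocks₁, csize])
    have hfetch : P[(addr (.pop k f q) s base, encStk S).1]? =
        some (Instr.pop k.val (tblOf fun o => addr q (f s o) (base + nσ))) := by
      show P[base + s.val * 1]? = _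
      rw [hP.getElem? (by rw [csize]; have := s.isLt; omega), code, getElem?_blocks₁]
    refine ((RunsPosB.single hfetch).trans (B₂ := csize q) ?_).mono (by rw [csize]; have := s.isLt; omega)
    dsimp only
    rw [Instr.apply, encStk_getD, tblIdx_head?_map, getD_tblOf, ← List.map_tail, ← encStk_update]
    simpa only [SStmt.toStmt, TM2.stepAux] using runsB_code q (base + nσ) hq (f s (S k).head?) _
  | .load f q, base, hP, s, S => by
    have hq : Placed E H P q (base + nσ) :=
      placed_of_append hP _ [] (by rw [code, List.append_nil]) (by rw [length_blocks₁])
        (by rw [length_blocks₁, csize])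
    have hfetch : P[(addr (.load f q) s base, encStk S).1]? =
        some (Instr.goto (addr q (f s) (base + nσ))) := by
      show P[base + s.val * 1]? = _
      rw [hP.getElem? (by rw [csize]; have := s.isLt; omega), code, getElem?_blocks₁]
    refine ((RunsPosB.single hfetch).trans (B₂ := csize q) ?_).mono (by rw [csize]; have := s.isLt; omega)
    dsimp only
    rw [Instr.apply]
    simpa only [SStmt.toStmt, TM2.stepAux] using runsB_code q (base + nσ) hq (f s) S
  | .branch p q₁ q₂, base, hP, s, S => by
    have hq₁ : Placed E H P q₁ (base + nσ) :=
      placed_of_append hP _ (code E H q₂ (base + nσ + csize q₁)) (by rw [code])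
        (by rw [length_blocks₁]) (by rw [length_blocks₁, csize]; omega)
    have hq₂ : Placed E H P q₂ (base + nσ + csize q₁) :=
      placed_of_append hP (_ ++ code E H q₁ (base + nσ)) []
        (by rw [code, List.append_nil, List.append_assoc])
        (by rw [List.length_append, length_blocks₁, length_code, Nat.add_assoc])
        (by rw [List.length_append, length_blocks₁, length_code, csize])
    have hfetch : P[(addr (.branch p q₁ q₂) s base, encStk S).1]? =
        some (Instr.goto (if p s then addr q₁ s (base + nσ) else addr q₂ s (base + nσ + csize q₁))) := by
      show P[base + s.val * 1]? = _
      rw [hP.getElem? (by rw [csize]; have := s.isLt; omega), code, getElem?_blocks₁]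
    cases hp : p s
    · refine ((RunsPosB.single hfetch).trans (B₂ := csize q₂) ?_).mono (by rw [csize]; have := s.isLt; omega)
      dsimp only
      rw [Instr.apply]
      simpa only [SStmt.toStmt, TM2.stepAux, hp, cond_false, Bool.false_eq_true, if_false] using
        runsB_code q₂ (base + nσ + csize q₁) hq₂ s S
    · refine ((RunsPosB.single hfetch).trans (B₂ := csize q₁) ?_).mono (by rw [csize]; have := s.isLt; omega)
      dsimp only
      rw [Instr.apply]
      simpa only [SStmt.toStmt, TM2.stepAux, hp, cond_true, if_true] using
        runsB_code q₁ (base + nσ) hq₁ s S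
  | .goto f, base, hP, s, S => by
    have hfetch : P[(addr (SStmt.goto f : SStmt nK N nΛ nσ) s base, encStk S).1]? =
        some (Instr.goto (E (f s) s)) := by
      show P[base + s.val * 1]? = _
      rw [hP.getElem? (by rw [csize]; have := s.isLt; omega), code, Nat.mul_one, List.getElem?_ofFn,
        dif_pos s.isLt]
    have hfin : fin (E := E) (H := H) (TM2.stepAux (SStmt.goto f : SStmt nK N nΛ nσ).toStmt s S) =
        (E (f s) s, encStk S) := rfl
    rw [hfin]
    exact (RunsPosB.single hfetch).mono (by rw [csize]; exact Nat.succ_le_of_lt s.pos)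
  | .halt, base, hP, s, S => by
    have hfetch : P[(addr (SStmt.halt : SStmt nK N nΛ nσ) s base, encStk S).1]? =
        some (Instr.goto H) := by
      show P[base + s.val * 1]? = _
      rw [hP.getElem? (by rw [csize]; have := s.isLt; omega), code, Nat.mul_one, List.getElem?_ofFn,
        dif_pos s.isLt]
    exact (RunsPosB.single hfetch).mono (by rw [csize]; exact Nat.succ_le_of_lt s.pos)

/-- **Simulation of one statement** (without the step count). [cite: AroraBarakCC2009, §1.4 (machines as strings)] -/
theorem runs_code {P : Prog} (q : SStmt nK N nΛ nσ) (base : ℕ) (hP : Placed E H P q base)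
    (s : Fin nσ) (S : Fin nK → List (Fin (N + 1))) :
    RunsPos P (addr q s base, encStk S) (fin (E := E) (H := H) (TM2.stepAux q.toStmt s S)) :=
  (runsB_code q base hP s S).runsPos

end Compile

/-! ### Compilation of a standard machine -/

section Machine

variable (c : SCode)

/-- The code sizes of the labels. [folklore] -/
def sizes : List ℕ :=
  List.ofFn fun l : Fin c.nΛ => csize (nσ := c.nσ) (c.prog l)

/-- The address of the code of label `l`: the sizes of the earlier labels. [folklore] -/
def off (l : Fin c.nΛ) : ℕ :=
  ((sizes c).take l.val).sum

/-- The halt address: the total size of the program. [folklore] -/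
def haltAddr : ℕ :=
  (sizes c).sum

/-- The entry address of label `l` at state `s` (the state-`s` block of its statement).
[cite: AroraBarakCC2009, §1.4 (machines as strings)] -/
def entry (l : Fin c.nΛ) (s : Fin c.nσ) : ℕ :=
  addr (c.prog l) s (off c l)

/-- **The flat program of a standard machine**: the codes of its labels one after the other.
[cite: AroraBarakCC2009, §1.4] -/
def compile : Prog :=
  (List.ofFn fun l : Fin c.nΛ => code (entry c) (haltAddr c) (c.prog l) (off c l)).flatten

/-- The flat program has length `haltAddr`. [folklore] -/
theorem length_compile : (compile c).length = haltAddr c := by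
  rw [compile, List.length_flatten, List.map_ofFn, haltAddr, sizes]
  congr 1
  exact List.ofFn_inj.2 (funext fun l => length_code _ _ _ _)

/-- The code of every label is placed at its address. [folklore] -/
theorem placed_prog (l : Fin c.nΛ) :
    Placed (entry c) (haltAddr c) (compile c) (c.prog l) (off c l) := by
  intro i hi
  have hl : (List.ofFn fun l : Fin c.nΛ => code (entry c) (haltAddr c) (c.prog l) (off c l))[l.val]? =
      some (code (entry c) (haltAddr c) (c.prog l) (off c l)) := by
    rw [List.getElem?_ofFn, dif_pos l.isLt]
  have key := getElem?_flatten_offset _ l.val _ hl i (by rw [length_code]; exact hi)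
  have hoff : (((List.ofFn fun l : Fin c.nΛ => code (entry c) (haltAddr c) (c.prog l) (off c l)).take
      l.val).map List.length).sum = off c l := by
    rw [off, sizes, List.map_take, List.map_ofFn]
    congr 2
    exact List.ofFn_inj.2 (funext fun l => length_code _ _ _ _)
  rw [hoff] at key
  rw [compile, key]

/-- **The coding of machine configurations**: label `l` at state `s` ↦ entry of `l` at `s`,
halted ↦ `haltAddr`; stacks as lists of symbol numbers. [cite: AroraBarakCC2009, §1.4] -/
def trCfg (a : c.tm.Cfg) : Cfg :=
  fin (E := entry c) (H := haltAddr c) a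

/-- The stacks of a coded configuration. [folklore] -/
@[simp] theorem trCfg_snd (a : c.tm.Cfg) : (trCfg c a).2 = encStk a.stk := rfl

/-- A halted configuration is coded with program counter `haltAddr`. [folklore] -/
theorem trCfg_fst_of_none {a : c.tm.Cfg} (h : a.l = none) : (trCfg c a).1 = haltAddr c := by
  obtain ⟨l, v, S⟩ := a
  cases h
  rfl

/-- A running configuration is coded with program counter inside the program. [folklore] -/
theorem trCfg_fst_lt_of_some {a : c.tm.Cfg} {l : Fin c.nΛ} (h : a.l = some l) :
    (trCfg c a).1 < haltAddr c := by
  obtain ⟨l', v, S⟩ := a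
  cases h
  show off c l + v.val * blen (c.prog l) < (sizes c).sum
  have h1 : v.val * blen (c.prog l) < csize (nσ := c.nσ) (c.prog l) := by
    have hv := v.isLt
    cases c.prog l <;> simp only [blen, csize] <;> nlinarith
  have h2 : off c l + csize (nσ := c.nσ) (c.prog l) ≤ (sizes c).sum := by
    have hl : l.val < (sizes c).length := by rw [sizes, List.length_ofFn]; exact l.isLt
    have hget : (sizes c)[l.val] = csize (nσ := c.nσ) (c.prog l) := by simp [sizes]
    rw [off, ← List.sum_take_add_sum_drop (sizes c) l.val, List.drop_eq_getElem_cons hl,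
      List.sum_cons, hget]
    omega
  omega

/-- The machine halts exactly at label `none`. [Mathlib `Turing.TM2.step`] [folklore] -/
theorem step_eq_none_iff (a : c.tm.Cfg) : c.tm.step a = none ↔ a.l = none := by
  obtain ⟨_ | l, v, S⟩ := a
  · exact ⟨fun _ => rfl, fun _ => rfl⟩
  · exact ⟨fun h => (by cases h), fun h => (by cases h)⟩

/-- **Simulation of one machine step**: a step of the standard machine is matched by a positive
number of steps of its flat program, all inside the program. [cite: AroraBarakCC2009, §1.4 (machines as strings)] -/
theorem runs_step {a b : c.tm.Cfg} (h : c.tm.step a = some b) :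
    RunsPos (compile c) (trCfg c a) (trCfg c b) := by
  obtain ⟨_ | l, v, S⟩ := a
  · cases h
  · cases h
    exact runs_code (c.prog l) (off c l) (placed_prog c l) v S

/-- **One machine step takes at most `haltAddr` flat steps.** [cite: AroraBarakCC2009, §1.4 (machines as strings)] -/
theorem runsB_step {a b : c.tm.Cfg} (h : c.tm.step a = some b) :
    RunsPosB (compile c) (haltAddr c) (trCfg c a) (trCfg c b) := by
  obtain ⟨_ | l, v, S⟩ := a
  · cases h
  · cases h
    refine (runsB_code (c.prog l) (off c l) (placed_prog c l) v S).mono ?_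
    have hl : l.val < (sizes c).length := by rw [sizes, List.length_ofFn]; exact l.isLt
    have hget : (sizes c)[l.val] = csize (nσ := c.nσ) (c.prog l) := by simp [sizes]
    rw [haltAddr, ← List.sum_take_add_sum_drop (sizes c) l.val, List.drop_eq_getElem_cons hl,
      List.sum_cons, hget]
    omega

/-- The total number of stack symbols of an untyped configuration. [folklore] -/
def stkTotal (S : List (List ℕ)) : ℕ := (S.map List.length).sum

/-- Writing a stack changes the total by the change of that stack. [folklore] -/
theorem stkTotal_set (S : List (List ℕ)) (k : ℕ) (L : List ℕ) (hk : k < S.length) :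
    stkTotal (S.set k L) + (S[k]).length = stkTotal S + L.length := by
  induction S generalizing k with
  | nil => exact absurd hk (Nat.not_lt_zero _)
  | cons s S ih =>
    cases k with
    | zero => simp [stkTotal]; omega
    | succ k =>
      simp only [List.set_cons_succ, stkTotal, List.map_cons, List.sum_cons, List.getElem_cons_succ] at ih ⊢
      have := ih k (by simpa using hk)
      omega

/-- Pushing onto one stack adds one symbol (none if the stack does not exist). [folklore] -/
theorem stkTotal_modify_cons_le (a : ℕ) : ∀ (S : List (List ℕ)) (k : ℕ),
    stkTotal (S.modify k fun l => a :: l) ≤ stkTotal S + 1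
  | [], k => by rw [List.modify_nil]; exact Nat.le_succ _
  | s :: S, 0 => by rw [List.modify_zero_cons]; simp [stkTotal]; omega
  | s :: S, k + 1 => by
    rw [List.modify_succ_cons]
    have := stkTotal_modify_cons_le a S k
    simp only [stkTotal, List.map_cons, List.sum_cons] at this ⊢
    omega

/-- One instruction adds at most one symbol. [folklore] -/
theorem stkTotal_apply_le (i : Instr) (S : List (List ℕ)) : stkTotal (i.apply S).2 ≤ stkTotal S + 1 := by
  cases i with
  | goto j => exact Nat.le_succ _
  | push k a j => exact stkTotal_modify_cons_le a S k
  | pop k t =>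
    show stkTotal (S.set k (S.getD k []).tail) ≤ stkTotal S + 1
    by_cases hk : k < S.length
    · have := stkTotal_set S k (S.getD k []).tail hk
      rw [List.getD_eq_getElem?_getD, List.getElem?_eq_getElem hk, Option.getD_some] at this ⊢
      have ht : (S[k]).tail.length ≤ (S[k]).length := by rw [List.length_tail]; omega
      omega
    · rw [List.set_eq_of_length_le (not_lt.1 hk)]
      exact Nat.le_succ _

/-- One flat step adds at most one symbol. [folklore] -/
theorem stkTotal_step_le (P : Prog) (cfg : Cfg) : stkTotal (step P cfg).2 ≤ stkTotal cfg.2 + 1 := by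
  unfold step
  cases P[cfg.1]? with
  | none => exact Nat.le_succ _
  | some i => exact stkTotal_apply_le i cfg.2

/-- `n` flat steps add at most `n` symbols. [folklore] -/
theorem stkTotal_iterate_le (P : Prog) (cfg : Cfg) (n : ℕ) :
    stkTotal ((step P)^[n] cfg).2 ≤ stkTotal cfg.2 + n := by
  induction n with
  | zero => simp
  | succ n ih => rw [iterate_succ_apply']; have := stkTotal_step_le P ((step P)^[n] cfg); omega

/-- A halted configuration is a fixed point of the flat program. [folklore] -/
theorem step_trCfg_of_none {a : c.tm.Cfg} (h : c.tm.step a = none) :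
    step (compile c) (trCfg c a) = trCfg c a :=
  step_of_le (by rw [length_compile, trCfg_fst_of_none c ((step_eq_none_iff c a).1 h)])

/-- **Simulation of runs**: `t` steps of the standard machine are matched by at least `t` steps
of its flat program, all but the last configuration having the program counter inside the
program. [cite: AroraBarakCC2009, §1.4 (machines as strings)] -/
theorem exists_iterate_of_iterate (t : ℕ) : ∀ {a b : c.tm.Cfg},
    (flip bind c.tm.step)^[t] (some a) = some b →
      ∃ n, t ≤ n ∧ (step (compile c))^[n] (trCfg c a) = trCfg c b ∧
        ∀ m < n, ((step (compile c))^[m] (trCfg c a)).1 < haltAddr c := by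
  induction t with
  | zero =>
    intro a b h
    simp only [iterate_zero, id_eq, Option.some.injEq] at h
    subst h
    exact ⟨0, le_rfl, rfl, fun m hm => absurd hm (Nat.not_lt_zero m)⟩
  | succ t ih =>
    intro a b h
    rw [TM2Comp.iterate_bind_succ] at h
    cases ha : c.tm.step a with
    | none => rw [ha, TM2Comp.iterate_bind_none] at h; cases h
    | some a' =>
      rw [ha] at h
      obtain ⟨n, htn, hn, hlt⟩ := ih h
      obtain ⟨n₁, hn₁, e₁, p₁⟩ := runs_step c ha
      refine ⟨n + n₁, by omega, by rw [iterate_add_apply, e₁, hn], fun m hm => ?_⟩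
      by_cases hm₁ : m < n₁
      · rw [← length_compile]; exact p₁ m hm₁
      · obtain ⟨d, rfl⟩ := Nat.exists_eq_add_of_le (le_of_not_gt hm₁)
        rw [add_comm n₁ d, iterate_add_apply, e₁]
        exact hlt d (by omega)

/-- **The flat program counter stays inside the program while the machine runs**: if the machine
has not halted within `m` steps, the flat configuration after `m` steps is not halted.
[cite: AroraBarakCC2009, §1.4] -/
theorem fst_iterate_lt_of_isSome {a : c.tm.Cfg} {m : ℕ}
    (h : ((flip bind c.tm.step)^[m + 1] (some a)).isSome) :
    ((step (compile c))^[m] (trCfg c a)).1 < haltAddr c := by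
  obtain ⟨b, hb⟩ := Option.isSome_iff_exists.1 h
  obtain ⟨n, hmn, -, hlt⟩ := exists_iterate_of_iterate c (m + 1) hb
  exact hlt m (by omega)

/-- Reachability is witnessed by an iteration count (private twin of
`SpaceLoop.exists_iterate_of_reaches`, which is not imported here). [folklore] -/
private theorem exists_iterate_of_reaches {C : Type} {f : C → Option C} {a b : C}
    (h : StateTransition.Reaches f a b) : ∃ n, (flip bind f)^[n] (some a) = some b := by
  induction h with
  | refl => exact ⟨0, rfl⟩
  | tail _ hbc ih =>
    obtain ⟨n, hn⟩ := ih
    refine ⟨n + 1, ?_⟩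
    rw [iterate_succ_apply', hn]
    exact hbc

/-- **Halting runs**: if the machine reaches a halted configuration `b` from `a`, the flat program
reaches the (fixed) coded configuration of `b`, whose program counter is `haltAddr`, and stays
there. [cite: AroraBarakCC2009, §1.4] -/
theorem exists_iterate_eq_of_mem_eval {a b : c.tm.Cfg} (h : b ∈ StateTransition.eval c.tm.step a) :
    ∃ n, ∀ n', n ≤ n' → (step (compile c))^[n'] (trCfg c a) = trCfg c b ∧
      (trCfg c b).1 = haltAddr c := by
  obtain ⟨hreach, hb⟩ := StateTransition.mem_eval.1 h
  obtain ⟨t, ht⟩ := exists_iterate_of_reaches hreach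
  obtain ⟨n, -, hn, -⟩ := exists_iterate_of_iterate c t ht
  refine ⟨n, fun n' hn' => ⟨?_, trCfg_fst_of_none c ((step_eq_none_iff c b).1 hb)⟩⟩
  obtain ⟨d, rfl⟩ := Nat.exists_eq_add_of_le hn'
  rw [add_comm n d, iterate_add_apply, hn]
  exact iterate_step_of_le
    (by rw [length_compile, trCfg_fst_of_none c ((step_eq_none_iff c b).1 hb)]) d

end Machine

end FlatProg

end Literature.Computability.Complexity
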